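import Summits.ValiantsHypothesis.ValiantsHypothesis.Theorems.KPlusLogSqLawTropicalBLexStrict

/-!
# Route «KPlusLogSqLaw», crux `TropicalB` (stmt-ValiantsHypothesis-19771) — THE EPOCH LAW: valuation-separated exponent values force
# a LINEAR census, `n + 1 ≤ 2(K+1)(m+1) + 1 ≤ 2(K+1)(m+2)` terms in every dominant chain

HONEST FRAMING.  Helper toward the registered stubs `stub_tropThin` / `stub_tropFat` of `Cruxes/TropicalB/Lines/birth.lean` (crux
`Summit.ValiantsHypothesis.ValiantsHypothesis.Theses.KPlusLogSqLaw.TropicalB`, item stmt-ValiantsHypothesis-19771, route KPlusLogSqLaw, DRAFT;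
cell `pub-symmetroid`, seat val-sym-trop-p1 g12, 2026-08-27; `--supports … --as helper`).  A SECTOR law — the desk's support-grade proof
target of record `EpochLaw` (lead ruling R1545 (§2), 2026-08-26; typed as `def EpochLaw : Prop` in conjb-2 g7's `Sketch_g7.lean`, statements
only), proved here with a weaker separation constant and then in the exact typed shape.  It is the far corner of the lex sector
(`…TropicalBScaleSeparation`, `…TropicalBLexStrict`: separation of the exponent values by the SIZE `m` gives the odometer reading; separation by
size × valuation spread kills the carries); it bounds nothing for `TropicalB` in its window (the sector has bounded valuations AND lacunary
exponents, where `chain_le_mul_spread` / `NewtonPolygon.chain_le_valSpread` already forbid long chains one hypothesis at a time — the point is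
the LINEAR shape `O(K·m)`), and bears on neither `WeakLifting`, the doors, `MatrixDescartes` (stmt-ValiantsHypothesis-18050) nor VP ≠ VNP.

THE SETTING.  A dominance design `(d, v, ε)` of format `(m, K)` with valuations `|v| ≤ R` and exponent VALUES pairwise separated by a factor
`ρ` (`d l < d l' → ρ·d l < d l'`; equal values are allowed and behave as one class) where `2m ≤ ρ` and `4mR < ρ`; a chain `p₀, …, pₙ` of
unique optima at strictly increasing integer slopes `θ₀ < ⋯ < θₙ` with distinct consecutive terms (the hypotheses of `TropRootLawAt` without
the signs).  Call the value `D` FROZEN at the slope `θ ≠ 0` if `4mR < |θ|·D`.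

* `Epoch.weight_gap` / `weight_lt_of_frozen_pos` / `weight_lt_of_frozen_neg` — FREEZING EXCHANGE: if two present terms have equally many
  columns of every value above a frozen value `D` and `y` has more columns of value `D` than `x`, then `|θ|·(S y − S x) > 2mR ≥ |V y − V x|`
  (the columns of `x` below `D` carry values `< D/ρ ≤ D/(2m)`, so they sum to `≤ D/2`), hence `y` beats `x` at `θ > 0` and loses at `θ < 0`;
* `Epoch.countVal_eq_of_frozen` — hence ANY two optima at slopes of one sign have the same number of columns of every value frozen at both
  slopes (take the largest frozen value where they differ);
* `Epoch.eq_zero_of_unfrozen_lt` — TWO LIVE VALUES: of two distinct values not frozen at `θ` the smaller is `0` (`|θ|·ρ·D < |θ|·D' ≤ 4mR < ρ`);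
* `Epoch.sum_d_eq_frozen_add` — so the slope of a term is (frozen part) + `D₁`·#(columns of the live nonzero value `D₁`);
* `Epoch.card_sign_le` — the chain indices with `0 < θ_k` (resp. `θ_k < 0`) inject into (#frozen classes, #live nonzero columns)
  `∈ [0, K] × [0, m]`: the frozen class sets along the chain are pairwise `⊆`-comparable (so determined by their cardinality), and inside one
  frozen set the frozen parts of the slopes agree while the slopes are pairwise distinct;
* `Epoch.chain_le` — **THE EPOCH LAW**: `n + 1 ≤ 2(K+1)(m+1) + 1` (the slope `0` carries at most one term);
* `Epoch.epochLaw` — the typed target verbatim: `|v| ≤ R`, values separated by `16(m+1)²(R+1)`, signs `|ε| ≤ 1`, alternating dominant chain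
  `⇒ n + 1 ≤ 2(K+1)(m+2)`.

READING (located, conjb-2 g7): «`K` in `TropicalB` counts exponent values comparable at one θ-scale, not classes» — here at most ONE nonzero
value is comparable at each slope.  [folklore: exchange / convexity bookkeeping; statement and name are the cell's (conjb-2 g7 ROUND1e §2).]
-/

-- `Summit.ValiantsHypothesis.ValiantsHypothesis.…` repeats a component by the D-0017 layout
-- (single-conjunct summit), which the `dupNamespace` linter flags; the name is mandated.
set_option linter.dupNamespace false
set_option autoImplicit false

namespace Summit.ValiantsHypothesis.ValiantsHypothesis.Theorems.KPlusLogSqLaw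

namespace Epoch

open Summit.ValiantsHypothesis.ValiantsHypothesis.Theorems.MatrixDescartes.Negative
open Summit.ValiantsHypothesis.ValiantsHypothesis.Theorems.LacunarySymmetroidMatrixDescartes.TropicalCensus
open Finset
open scoped BigOperators

variable {m K : ℕ}

/-! ## 1. Bookkeeping: valuation sums and the part of the slope below a value -/

/-- the total valuation of a term is at most `m·R` in absolute value when `|v| ≤ R` entrywise. [folklore] -/
theorem abs_sum_v_le (v : Fin m → Fin m → Fin K → ℤ) (R : ℕ) (hv : ∀ i j l, (v i j l).natAbs ≤ R)
    (p : Equiv.Perm (Fin m) × (Fin m → Fin K)) : |∑ i, v (p.1 i) i (p.2 i)| ≤ (m : ℤ) * R := by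
  calc |∑ i, v (p.1 i) i (p.2 i)| ≤ ∑ i, |v (p.1 i) i (p.2 i)| := abs_sum_le_sum_abs _ _
    _ ≤ ∑ _i : Fin m, (R : ℤ) := sum_le_sum fun i _ => by
        rw [Int.abs_eq_natAbs]; exact_mod_cast hv _ _ _
    _ = (m : ℤ) * R := by rw [sum_const, card_univ, Fintype.card_fin, nsmul_eq_mul]

/-- the part of the slope strictly below a value `D` that is `ρ`-separated from every smaller value is at most `m·D/ρ`:
`ρ · Σ_{d(r i) < D} d (r i) ≤ m · D`. [folklore] -/
theorem rho_mul_sum_below_le (d : Fin K → ℕ) (ρ : ℕ) (r : Fin m → Fin K) (D : ℕ)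
    (hsepD : ∀ i, d (r i) < D → ρ * d (r i) < D) :
    ρ * ∑ i ∈ univ.filter (fun i => d (r i) < D), d (r i) ≤ m * D := by
  rw [mul_sum]
  calc ∑ i ∈ univ.filter (fun i => d (r i) < D), ρ * d (r i)
      ≤ ∑ _i ∈ univ.filter (fun i => d (r i) < D), D := sum_le_sum fun i hi => (hsepD i (mem_filter.mp hi).2).le
    _ = (univ.filter (fun i => d (r i) < D)).card * D := by rw [sum_const, smul_eq_mul]
    _ ≤ m * D := by
        refine Nat.mul_le_mul_right _ ?_
        exact (card_le_univ _).trans (by rw [Fintype.card_fin])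

/-! ## 2. The freezing exchange -/

/-- **FREEZING EXCHANGE (slope gap).**  Values `ρ`-separated with `2m ≤ ρ`; two class maps `x y : Fin m → Fin K` with equally many columns
of every value `> D` and `#{d = D}` larger for `y`; then `2·(S y − S x) ≥ D` where `S = Σᵢ d`, i.e. `D ≤ 2·(S y) − 2·(S x)` in `ℕ`
(and `S x < S y`). [folklore] -/
theorem two_mul_slope_gap (d : Fin K → ℕ) (ρ : ℕ) (hρm : 2 * m ≤ ρ) (hsep : ∀ l l' : Fin K, d l < d l' → ρ * d l < d l')
    (x y : Fin m → Fin K) (D : ℕ)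
    (habove : ∀ D' : ℕ, D < D' → (univ.filter fun i => d (x i) = D').card = (univ.filter fun i => d (y i) = D').card)
    (hcnt : (univ.filter fun i => d (x i) = D).card < (univ.filter fun i => d (y i) = D).card) :
    D + 2 * ∑ i, d (x i) ≤ 2 * ∑ i, d (y i) := by
  -- a column of `y` has value `D`, so `D` is a value of `d` and separation applies below it
  obtain ⟨i₀, hi₀⟩ : ∃ i, d (y i) = D := by
    have hpos : 0 < (univ.filter fun i => d (y i) = D).card := by omega
    obtain ⟨i, hi⟩ := card_pos.mp hpos
    exact ⟨i, (mem_filter.mp hi).2⟩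
  have hm : 0 < m := Fin.pos i₀
  have hbelow : ρ * ∑ i ∈ univ.filter (fun i => d (x i) < D), d (x i) ≤ m * D :=
    rho_mul_sum_below_le d ρ x D fun i hi => by rw [← hi₀] at hi ⊢; exact hsep _ _ hi
  have hbelow2 : 2 * ∑ i ∈ univ.filter (fun i => d (x i) < D), d (x i) ≤ D := by
    have h1 : m * (2 * ∑ i ∈ univ.filter (fun i => d (x i) < D), d (x i)) ≤ m * D := by
      calc m * (2 * ∑ i ∈ univ.filter (fun i => d (x i) < D), d (x i))
          = 2 * m * ∑ i ∈ univ.filter (fun i => d (x i) < D), d (x i) := by ring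
        _ ≤ ρ * ∑ i ∈ univ.filter (fun i => d (x i) < D), d (x i) := Nat.mul_le_mul_right _ hρm
        _ ≤ m * D := hbelow
    exact Nat.le_of_mul_le_mul_left h1 hm
  rw [sum_d_split3 d x D, sum_d_split3 d y D, sum_above_eq_of_countVal d x y D habove]
  have hDc : D * (univ.filter fun i => d (x i) = D).card + D ≤ D * (univ.filter fun i => d (y i) = D).card := by
    rw [← Nat.mul_succ]; exact Nat.mul_le_mul_left D hcnt
  omega

/-- **FREEZING EXCHANGE (weights).**  With `|v| ≤ R` in addition: if `D` is frozen at `θ` (`4mR < |θ|·D`) then the term with MORE columns of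
value `D` (and equally many of every larger value) has the larger tropical weight at `θ > 0` and the smaller at `θ < 0`:
`|θ|·(S y − S x) ≥ |θ|·D/2 > 2mR ≥ V y − V x`. [folklore] -/
theorem weight_gap (d : Fin K → ℕ) (v : Fin m → Fin m → Fin K → ℤ) (R ρ : ℕ) (hρm : 2 * m ≤ ρ)
    (hv : ∀ i j l, (v i j l).natAbs ≤ R) (hsep : ∀ l l' : Fin K, d l < d l' → ρ * d l < d l')
    {θ : ℤ} (x y : Equiv.Perm (Fin m) × (Fin m → Fin K)) (D : ℕ) (hD : 4 * m * R < θ.natAbs * D)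
    (habove : ∀ D' : ℕ, D < D' → (univ.filter fun i => d (x.2 i) = D').card = (univ.filter fun i => d (y.2 i) = D').card)
    (hcnt : (univ.filter fun i => d (x.2 i) = D).card < (univ.filter fun i => d (y.2 i) = D).card) :
    (0 < θ → tropWeight d v θ x < tropWeight d v θ y) ∧ (θ < 0 → tropWeight d v θ y < tropWeight d v θ x) := by
  have hgap := two_mul_slope_gap d ρ hρm hsep x.2 y.2 D habove hcnt
  have hVx := (abs_le.mp (abs_sum_v_le v R hv x))
  have hVy := (abs_le.mp (abs_sum_v_le v R hv y))
  -- cast the slope gap to `ℤ`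
  have hgapZ : (D : ℤ) + 2 * ∑ i, (d (x.2 i) : ℤ) ≤ 2 * ∑ i, (d (y.2 i) : ℤ) := by exact_mod_cast hgap
  have hDZ : 4 * (m : ℤ) * R < (θ.natAbs : ℤ) * D := by exact_mod_cast hD
  unfold tropWeight
  constructor
  · intro hθ
    have hθ' : (θ.natAbs : ℤ) = θ := Int.natAbs_of_nonneg hθ.le
    rw [hθ'] at hDZ
    nlinarith
  · intro hθ
    have hθ' : (θ.natAbs : ℤ) = -θ := Int.ofNat_natAbs_of_nonpos hθ.le
    rw [hθ'] at hDZ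
    nlinarith


/-! ## 3. Agreement of frozen value counts between two optima -/

/-- a value at which two class maps have different column counts is a value of some class. [folklore] -/
theorem exists_class_of_countVal_ne (d : Fin K → ℕ) (x y : Fin m → Fin K) (D : ℕ)
    (h : (univ.filter fun i => d (x i) = D).card ≠ (univ.filter fun i => d (y i) = D).card) : ∃ l : Fin K, d l = D := by
  by_cases h0 : (univ.filter fun i => d (x i) = D).card = 0
  · have hy : 0 < (univ.filter fun i => d (y i) = D).card := by omega
    obtain ⟨i, hi⟩ := card_pos.mp hy
    exact ⟨y i, (mem_filter.mp hi).2⟩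
  · obtain ⟨i, hi⟩ := card_pos.mp (Nat.pos_of_ne_zero h0)
    exact ⟨x i, (mem_filter.mp hi).2⟩


/-- **AGREEMENT.**  Two unique optima `p` (at `θa`) and `q` (at `θb`), both slopes positive or both negative, have the same number of columns
of every value `D` frozen at both slopes (`4mR < |θa|·D`, `4mR < |θb|·D`).  Proof: at the largest frozen value where they differ the freezing
exchange makes one of them lose at its own slope. [folklore] -/
theorem countVal_eq_of_frozen (d : Fin K → ℕ) (v ε : Fin m → Fin m → Fin K → ℤ) (R ρ : ℕ) (hρm : 2 * m ≤ ρ)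
    (hv : ∀ i j l, (v i j l).natAbs ≤ R) (hsep : ∀ l l' : Fin K, d l < d l' → ρ * d l < d l')
    {θa θb : ℤ} (hsign : (0 < θa ∧ 0 < θb) ∨ (θa < 0 ∧ θb < 0))
    {p q : Equiv.Perm (Fin m) × (Fin m → Fin K)} (ha : IsDominant d v ε θa p) (hb : IsDominant d v ε θb q) :
    ∀ D : ℕ, 4 * m * R < θa.natAbs * D → 4 * m * R < θb.natAbs * D →
      (univ.filter fun i => d (p.2 i) = D).card = (univ.filter fun i => d (q.2 i) = D).card := by
  by_contra hcon
  push Not at hcon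
  obtain ⟨D₀, hD₀a, hD₀b, hD₀ne⟩ := hcon
  -- the set of frozen CLASSES whose value count differs is nonempty; take one of maximal value
  set T : Finset (Fin K) := univ.filter fun l =>
    4 * m * R < θa.natAbs * d l ∧ 4 * m * R < θb.natAbs * d l ∧
      (univ.filter fun i => d (p.2 i) = d l).card ≠ (univ.filter fun i => d (q.2 i) = d l).card with hT
  have hTne : T.Nonempty := by
    obtain ⟨l, hl⟩ := exists_class_of_countVal_ne d p.2 q.2 D₀ hD₀ne
    exact ⟨l, mem_filter.mpr ⟨mem_univ _, by rw [hl]; exact ⟨hD₀a, hD₀b, hD₀ne⟩⟩⟩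
  obtain ⟨l₀, hl₀T, hl₀max⟩ := exists_max_image T d hTne
  obtain ⟨hfa, hfb, hne⟩ := (mem_filter.mp hl₀T).2
  set D := d l₀ with hD
  -- above `D` the counts agree (maximality)
  have habove : ∀ D' : ℕ, D < D' →
      (univ.filter fun i => d (p.2 i) = D').card = (univ.filter fun i => d (q.2 i) = D').card := by
    intro D' hDD'
    by_contra hne'
    obtain ⟨l, hl⟩ := exists_class_of_countVal_ne d p.2 q.2 D' hne'
    have hfa' : 4 * m * R < θa.natAbs * d l := hfa.trans_le (by rw [hl]; exact Nat.mul_le_mul_left _ hDD'.le)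
    have hfb' : 4 * m * R < θb.natAbs * d l := hfb.trans_le (by rw [hl]; exact Nat.mul_le_mul_left _ hDD'.le)
    have hlT : l ∈ T := mem_filter.mpr ⟨mem_univ _, hfa', hfb', by rw [hl]; exact hne'⟩
    have := hl₀max l hlT
    rw [hl] at this
    exact absurd hDD' (not_lt.mpr this)
  have hpq : p ≠ q := by rintro rfl; exact hne rfl
  rcases Nat.lt_or_gt_of_ne hne with hlt | hgt
  · -- `q` has more columns of value `D`
    rcases hsign with ⟨ha0, _⟩ | ⟨_, hb0⟩
    · -- at `θa > 0`, `q` beats `p`: contradicts the dominance of `p`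
      have h := (weight_gap d v R ρ hρm hv hsep p q D hfa habove hlt).1 ha0
      exact absurd h (not_lt.mpr (ha.2 q hpq.symm hb.1).le)
    · -- at `θb < 0`, `q` loses to `p`: contradicts the dominance of `q`
      have h := (weight_gap d v R ρ hρm hv hsep p q D hfb habove hlt).2 hb0
      exact absurd h (not_lt.mpr (hb.2 p hpq ha.1).le)
  · -- `p` has more columns of value `D`
    have habove' : ∀ D' : ℕ, D < D' →
        (univ.filter fun i => d (q.2 i) = D').card = (univ.filter fun i => d (p.2 i) = D').card :=
      fun D' h => (habove D' h).symm
    rcases hsign with ⟨_, hb0⟩ | ⟨ha0, _⟩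
    · have h := (weight_gap d v R ρ hρm hv hsep q p D hfb habove' hgt).1 hb0
      exact absurd h (not_lt.mpr (hb.2 p hpq ha.1).le)
    · have h := (weight_gap d v R ρ hρm hv hsep q p D hfa habove' hgt).2 ha0
      exact absurd h (not_lt.mpr (ha.2 q hpq.symm hb.1).le)

/-! ## 4. Two live values and the slope of a term inside an epoch -/

/-- **TWO LIVE VALUES.**  If `4mR < ρ` and the values are `ρ`-separated, then of two distinct values `d l < d l'` with the larger NOT frozen at
`θ ≠ 0` (`|θ|·d l' ≤ 4mR`) the smaller is `0`: `|θ|·ρ·d l < |θ|·d l' ≤ 4mR < ρ`. [folklore] -/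
theorem eq_zero_of_unfrozen_lt (d : Fin K → ℕ) (R ρ : ℕ) (hρR : 4 * m * R < ρ)
    (hsep : ∀ l l' : Fin K, d l < d l' → ρ * d l < d l') {θ : ℤ} (hθ : θ ≠ 0) {l l' : Fin K} (hlt : d l < d l')
    (hl' : θ.natAbs * d l' ≤ 4 * m * R) : d l = 0 := by
  have ht : 1 ≤ θ.natAbs := Int.natAbs_pos.mpr hθ
  have h1 : θ.natAbs * (ρ * d l) < ρ * 1 := by
    calc θ.natAbs * (ρ * d l) ≤ θ.natAbs * d l' := Nat.mul_le_mul_left _ (hsep l l' hlt).le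
      _ ≤ 4 * m * R := hl'
      _ < ρ * 1 := by rw [mul_one]; exact hρR
  have h2 : ρ * (θ.natAbs * d l) < ρ * 1 := by rw [mul_left_comm]; exact h1
  have h3 : θ.natAbs * d l < 1 := Nat.lt_of_mul_lt_mul_left h2
  rcases Nat.mul_eq_zero.mp (Nat.lt_one_iff.mp h3) with h | h <;> omega

/-- **SLOPE INSIDE AN EPOCH.**  If every column whose value is not above the threshold `τ` carries the value `0` or `D₁`, then
`Σᵢ d (r i) = Σ_{τ < d (r i)} d (r i) + D₁ · #{i : d (r i) ≤ τ, d (r i) ≠ 0}`. [folklore] -/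
theorem sum_d_eq_frozen_add (d : Fin K → ℕ) (r : Fin m → Fin K) (τ D₁ : ℕ)
    (hlive : ∀ i, ¬ τ < d (r i) → d (r i) ≠ 0 → d (r i) = D₁) :
    ∑ i, d (r i) = ∑ i ∈ univ.filter (fun i => τ < d (r i)), d (r i) +
      D₁ * (univ.filter fun i => ¬ τ < d (r i) ∧ d (r i) ≠ 0).card := by
  rw [← sum_filter_add_sum_filter_not univ (fun i => τ < d (r i))]
  congr 1
  rw [← sum_filter_add_sum_filter_not (univ.filter fun i => ¬ τ < d (r i)) (fun i => d (r i) ≠ 0), filter_filter,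
    filter_filter]
  have hzero : ∑ i ∈ univ.filter (fun i => ¬ τ < d (r i) ∧ ¬ d (r i) ≠ 0), d (r i) = 0 :=
    sum_eq_zero fun i hi => by have := (mem_filter.mp hi).2.2; push Not at this; exact this
  rw [hzero, add_zero, sum_congr rfl (fun i hi => hlive i (mem_filter.mp hi).2.1 (mem_filter.mp hi).2.2), sum_const,
    smul_eq_mul, mul_comm]

/-- thresholds: for `t > 0`, `4mR < t·D ↔ 4mR / t < D`. [arithmetic] -/
theorem frozen_iff_div_lt {t R D : ℕ} (m : ℕ) (ht : 0 < t) : 4 * m * R < t * D ↔ 4 * m * R / t < D := by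
  rw [Nat.div_lt_iff_lt_mul ht, Nat.mul_comm D t]


/-! ## 5. Counting: epochs of one sign, and the law -/

/-- **EPOCH COUNT (one sign).**  Along a dominant chain with distinct consecutive terms, the indices `k` with `0 < σ·θ_k` (`σ = ±1`) number
at most `(K+1)(m+1)`: the map `k ↦ (#{classes frozen at θ_k}, #{columns of p_k of nonzero non-frozen value})` is injective on them —
the frozen class sets are pairwise `⊆`-comparable (so determined by their size), and two indices with the same frozen set have equal frozen
parts of the slope (`countVal_eq_of_frozen`, `sum_above_eq_of_countVal`) and the same single live nonzero value (`eq_zero_of_unfrozen_lt`),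
while their slopes differ. [folklore] -/
theorem card_sign_le (d : Fin K → ℕ) (v ε : Fin m → Fin m → Fin K → ℤ) (R ρ : ℕ) (hρm : 2 * m ≤ ρ) (hρR : 4 * m * R < ρ)
    (hv : ∀ i j l, (v i j l).natAbs ≤ R) (hsep : ∀ l l' : Fin K, d l < d l' → ρ * d l < d l')
    {n : ℕ} (θ : Fin (n + 1) → ℤ) (p : Fin (n + 1) → Equiv.Perm (Fin m) × (Fin m → Fin K))
    (hθ : StrictMono θ) (hdom : ∀ k, IsDominant d v ε (θ k) (p k)) (hne : ∀ k : Fin n, p k.castSucc ≠ p k.succ)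
    (σ : ℤ) (hσ : σ = 1 ∨ σ = -1) :
    (univ.filter fun k => 0 < σ * θ k).card ≤ (K + 1) * (m + 1) := by
  classical
  -- slopes strictly increase along the chain
  have hsm : StrictMono fun k => ∑ i, d ((p k).2 i) := by
    refine Fin.strictMono_iff_lt_succ.mpr fun k => ?_
    exact sum_d_lt_of_dominant d v ε (hθ k.castSucc_lt_succ) (hne k) (hdom _) (hdom _)
  -- thresholds, frozen class sets, live nonzero columns
  set τ : Fin (n + 1) → ℕ := fun k => 4 * m * R / (θ k).natAbs with hτ
  set F : Fin (n + 1) → Finset (Fin K) := fun k => univ.filter fun l => τ k < d l with hF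
  set u : Fin (n + 1) → ℕ := fun k =>
    (univ.filter fun i => ¬ τ k < d ((p k).2 i) ∧ d ((p k).2 i) ≠ 0).card with hu
  set φ : Fin (n + 1) → ℕ × ℕ := fun k => ((F k).card, u k) with hφ
  have hmaps : ∀ k ∈ univ.filter (fun k => 0 < σ * θ k), φ k ∈ range (K + 1) ×ˢ range (m + 1) := by
    intro k _
    simp only [hφ, hF, hu, mem_product, mem_range]
    exact ⟨Nat.lt_succ_of_le ((card_le_univ _).trans (by rw [Fintype.card_fin])),
      Nat.lt_succ_of_le ((card_le_univ _).trans (by rw [Fintype.card_fin]))⟩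
  have hinj : Set.InjOn φ ↑(univ.filter fun k => 0 < σ * θ k) := by
    intro k hk k' hk' hkk'
    rw [coe_filter, Set.mem_setOf_eq] at hk hk'
    obtain ⟨hcard, huu⟩ := Prod.mk.inj hkk'
    -- signs
    have hsign : (0 < θ k ∧ 0 < θ k') ∨ (θ k < 0 ∧ θ k' < 0) := by
      rcases hσ with rfl | rfl
      · left; constructor <;> linarith [hk.2, hk'.2]
      · right; constructor <;> linarith [hk.2, hk'.2]
    have hθk : θ k ≠ 0 := by rcases hsign with ⟨h, _⟩ | ⟨h, _⟩ <;> first | exact h.ne' | exact h.ne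
    have hθk' : θ k' ≠ 0 := by rcases hsign with ⟨_, h⟩ | ⟨_, h⟩ <;> first | exact h.ne' | exact h.ne
    have htk : 0 < (θ k).natAbs := Int.natAbs_pos.mpr hθk
    have htk' : 0 < (θ k').natAbs := Int.natAbs_pos.mpr hθk'
    -- Step 1: the frozen class sets coincide (comparable + equal size)
    have hFeq : F k = F k' := by
      rcases le_total (τ k) (τ k') with h | h
      · exact (eq_of_subset_of_card_le (fun l hl => mem_filter.mpr ⟨mem_univ _,
          h.trans_lt (mem_filter.mp hl).2⟩) hcard.le).symm
      · exact eq_of_subset_of_card_le (fun l hl => mem_filter.mpr ⟨mem_univ _,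
          h.trans_lt (mem_filter.mp hl).2⟩) hcard.ge
    have hFiff : ∀ l : Fin K, τ k < d l ↔ τ k' < d l := fun l => by
      have h := Finset.ext_iff.mp hFeq l
      simp only [hF, mem_filter, mem_univ, true_and] at h
      exact h
    -- Step 2: the single live nonzero value at `θ k`
    have unfrozen : ∀ l : Fin K, ¬ τ k < d l → (θ k).natAbs * d l ≤ 4 * m * R := by
      intro l hl
      push Not at hl
      calc (θ k).natAbs * d l ≤ (θ k).natAbs * (4 * m * R / (θ k).natAbs) := Nat.mul_le_mul_left _ hl
        _ ≤ 4 * m * R := Nat.mul_div_le _ _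
    obtain ⟨D₁, hlive⟩ : ∃ D₁ : ℕ, ∀ l : Fin K, ¬ τ k < d l → d l ≠ 0 → d l = D₁ := by
      by_cases h : ∃ l : Fin K, ¬ τ k < d l ∧ d l ≠ 0
      · obtain ⟨l₁, hl₁τ, hl₁0⟩ := h
        refine ⟨d l₁, fun l hlτ hl0 => ?_⟩
        rcases lt_trichotomy (d l) (d l₁) with hlt | heq | hgt
        · exact absurd (eq_zero_of_unfrozen_lt d R ρ hρR hsep hθk hlt (unfrozen l₁ hl₁τ)) hl0
        · exact heq
        · exact absurd (eq_zero_of_unfrozen_lt d R ρ hρR hsep hθk hgt (unfrozen l hlτ)) hl₁0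
      · push Not at h
        exact ⟨0, fun l hl hl0 => absurd (h l (not_lt.mp hl)) hl0⟩
    -- Step 3: frozen value counts agree, hence the frozen parts of the slopes agree
    have hagree : ∀ D' : ℕ, τ k < D' →
        (univ.filter fun i => d ((p k).2 i) = D').card = (univ.filter fun i => d ((p k').2 i) = D').card := by
      intro D' hD'
      by_contra hneq
      obtain ⟨l, hl⟩ := exists_class_of_countVal_ne d (p k).2 (p k').2 D' hneq
      have hfk : 4 * m * R < (θ k).natAbs * D' := (frozen_iff_div_lt m htk).mpr hD'
      have hfk' : 4 * m * R < (θ k').natAbs * D' := by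
        have h1 : τ k' < d l := (hFiff l).mp (hl ▸ hD')
        rw [hl] at h1
        exact (frozen_iff_div_lt m htk').mpr h1
      exact hneq (countVal_eq_of_frozen d v ε R ρ hρm hv hsep hsign (hdom k) (hdom k') D' hfk hfk')
    have hA : ∑ i ∈ univ.filter (fun i => τ k < d ((p k).2 i)), d ((p k).2 i) =
        ∑ i ∈ univ.filter (fun i => τ k < d ((p k').2 i)), d ((p k').2 i) :=
      sum_above_eq_of_countVal d (p k).2 (p k').2 (τ k) hagree
    -- Step 4: slope formulas at the common threshold `τ k`
    have hSk := sum_d_eq_frozen_add d (p k).2 (τ k) D₁ fun i h1 h2 => hlive _ h1 h2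
    have hSk' := sum_d_eq_frozen_add d (p k').2 (τ k) D₁ fun i h1 h2 => hlive _ h1 h2
    have hu' : (univ.filter fun i => ¬ τ k < d ((p k').2 i) ∧ d ((p k').2 i) ≠ 0) =
        (univ.filter fun i => ¬ τ k' < d ((p k').2 i) ∧ d ((p k').2 i) ≠ 0) :=
      filter_congr fun i _ => by rw [hFiff]
    have huk' : (univ.filter fun i => ¬ τ k < d ((p k').2 i) ∧ d ((p k').2 i) ≠ 0).card = u k := by
      rw [hu', huu]
    -- Step 5: equal slopes force equal indices
    by_contra hkne
    have hS : ∑ i, d ((p k).2 i) ≠ ∑ i, d ((p k').2 i) := fun h => hkne (hsm.injective h)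
    apply hS
    rw [hSk, hSk', hA, huk']
  calc (univ.filter fun k => 0 < σ * θ k).card ≤ (range (K + 1) ×ˢ range (m + 1)).card :=
        card_le_card_of_injOn φ hmaps hinj
    _ = (K + 1) * (m + 1) := by rw [card_product, card_range, card_range]


/-- **THE EPOCH LAW.**  In a dominance design of format `(m, K)` with valuations `|v| ≤ R` and exponent values `ρ`-separated
(`d l < d l' → ρ·d l < d l'`) for some `ρ ≥ 2m` with `ρ > 4mR`, every chain of unique optima at strictly increasing integer slopes with
distinct consecutive terms has `n + 1 ≤ 2(K+1)(m+1) + 1` terms: `(K+1)(m+1)` at positive slopes, as many at negative slopes, one at slope `0`.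
[folklore: exchange bookkeeping; target `EpochLaw` of the cell] -/
theorem chain_le (d : Fin K → ℕ) (v ε : Fin m → Fin m → Fin K → ℤ) (R ρ : ℕ) (hρm : 2 * m ≤ ρ) (hρR : 4 * m * R < ρ)
    (hv : ∀ i j l, (v i j l).natAbs ≤ R) (hsep : ∀ l l' : Fin K, d l < d l' → ρ * d l < d l')
    {n : ℕ} (θ : Fin (n + 1) → ℤ) (p : Fin (n + 1) → Equiv.Perm (Fin m) × (Fin m → Fin K))
    (hθ : StrictMono θ) (hdom : ∀ k, IsDominant d v ε (θ k) (p k)) (hne : ∀ k : Fin n, p k.castSucc ≠ p k.succ) :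
    n + 1 ≤ 2 * (K + 1) * (m + 1) + 1 := by
  classical
  have hpos := card_sign_le d v ε R ρ hρm hρR hv hsep θ p hθ hdom hne 1 (Or.inl rfl)
  have hneg := card_sign_le d v ε R ρ hρm hρR hv hsep θ p hθ hdom hne (-1) (Or.inr rfl)
  -- at most one index carries the slope `0`
  have hzero : (univ.filter fun k => θ k = 0).card ≤ 1 := by
    refine card_le_one.mpr fun a ha b hb => hθ.injective ?_
    rw [(mem_filter.mp ha).2, (mem_filter.mp hb).2]
  have hcover : (univ : Finset (Fin (n + 1))) ⊆
      ((univ.filter fun k => 0 < (1 : ℤ) * θ k) ∪ (univ.filter fun k => 0 < (-1 : ℤ) * θ k)) ∪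
        (univ.filter fun k => θ k = 0) := by
    intro k _
    rcases lt_trichotomy (θ k) 0 with h | h | h
    · exact mem_union_left _ (mem_union_right _ (mem_filter.mpr ⟨mem_univ _, by linarith⟩))
    · exact mem_union_right _ (mem_filter.mpr ⟨mem_univ _, h⟩)
    · exact mem_union_left _ (mem_union_left _ (mem_filter.mpr ⟨mem_univ _, by linarith⟩))
  calc n + 1 = (univ : Finset (Fin (n + 1))).card := by rw [card_univ, Fintype.card_fin]
    _ ≤ (((univ.filter fun k => 0 < (1 : ℤ) * θ k) ∪ (univ.filter fun k => 0 < (-1 : ℤ) * θ k)) ∪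
          (univ.filter fun k => θ k = 0)).card := card_le_card hcover
    _ ≤ ((univ.filter fun k => 0 < (1 : ℤ) * θ k).card + (univ.filter fun k => 0 < (-1 : ℤ) * θ k).card) +
          (univ.filter fun k => θ k = 0).card :=
        (card_union_le _ _).trans (Nat.add_le_add_right (card_union_le _ _) _)
    _ ≤ ((K + 1) * (m + 1) + (K + 1) * (m + 1)) + 1 := Nat.add_le_add (Nat.add_le_add hpos hneg) hzero
    _ = 2 * (K + 1) * (m + 1) + 1 := by ring

/-- **`EpochLaw` — the typed target verbatim** (conjb-2 g7 `Sketch_g7.lean`, desk R1545 (§2)): valuations bounded by `R` in absolute value,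
every pair of distinct exponent VALUES separated by the factor `16(m+1)²(R+1)`, signs in `{−1, 0, 1}`, a dominant sign-alternating chain at
strictly increasing integer slopes — then the chain has at most `2(K+1)(m+2)` terms.  (From `chain_le` with `ρ = 16(m+1)²(R+1) ≥ 2m`,
`> 4mR`; alternating signs make consecutive terms distinct; `2(K+1)(m+1) + 1 ≤ 2(K+1)(m+2)`.) [folklore; target `EpochLaw` of the cell] -/
theorem epochLaw :
    ∀ (m K R : ℕ) (d : Fin K → ℕ) (v ε : Fin m → Fin m → Fin K → ℤ) (n : ℕ) (θ : Fin (n + 1) → ℤ)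
      (p : Fin (n + 1) → Equiv.Perm (Fin m) × (Fin m → Fin K)),
      (∀ i j l, (v i j l).natAbs ≤ R) →
      (∀ l l', d l < d l' → 16 * (m + 1) ^ 2 * (R + 1) * d l < d l') →
      (∀ i j l, (ε i j l).natAbs ≤ 1) → StrictMono θ → (∀ k, IsDominant d v ε (θ k) (p k)) →
      (∀ k : Fin n, termSign ε (p k.castSucc) * termSign ε (p k.succ) < 0) →
      n + 1 ≤ 2 * (K + 1) * (m + 2) := by
  intro m K R d v ε n θ p hv hsep _hε hθ hdom halt
  have hne : ∀ k : Fin n, p k.castSucc ≠ p k.succ := by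
    intro k h
    have := halt k
    rw [h] at this
    exact absurd this (not_lt.mpr (mul_self_nonneg _))
  have hρm : 2 * m ≤ 16 * (m + 1) ^ 2 * (R + 1) := by nlinarith
  have hρR : 4 * m * R < 16 * (m + 1) ^ 2 * (R + 1) := by nlinarith
  have h := chain_le d v ε R (16 * (m + 1) ^ 2 * (R + 1)) hρm hρR hv hsep θ p hθ hdom hne
  nlinarith

end Epoch

end Summit.ValiantsHypothesis.ValiantsHypothesis.Theorems.KPlusLogSqLaw
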